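import Mathlib
import Summits.KontsevichZagierPeriods.Zeta5Search.BrickResidueLawCirc
import Summits.KontsevichZagierPeriods.Zeta5Search.BrickHoleCells

/-!
# BrickLevelReduction — THEOREM 8 one-level REDUCTION: for a row `n = n₀ + Np` of either kernel and any weight
`g ∈ ℤ_(p)`, `Σ_{k≤n} g(k)·r_k^{(s)}(n) ≡ Σ_{K≤N} W(K)·r̃_K^{(s)}(N) (mod p^{L+1})` with the DEGREE-ZERO BLOCK
WEIGHT `W(K) = Σ_{k₀≤n₀} g(k₀+Kp)·λ_{k₀+Kp}` (hole cells discarded termwise; cell zeta5-irr)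

HONEST FRAMING: systematic search; no irrationality claim unless certified. INSTRUMENT lemmas of the ζ(5)
census cell zeta5-irr (HOME `run/shared/lean/pub/zeta5-irr/`; memo `zi-p2/probes/B8/thm8/THEOREM8.md` §2 proof of
PROPOSITION H° steps (1)–(2): «(1) HOLES, TERMWISE: g(k) ∈ ℤ_(p) and (K) give v(g(k)r̃_k^{(s)}(M)) ≥ A ≥ ℓ … (2)
RESIDUE LAW ON ° CELLS … Σ_{k∈°} g(k)r̃_k^{(s)}(M) ≡ Σ_{k′=0}^{M′} W°(k′)·r̃_{k′}^{(s)}(M′) (mod p^ℓ), W°(k′) :=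
Σ_{k₀=0}^{M₀} g(k′p+k₀)λ̃_{k′p+k₀}» and the same step of DIGIT THEOREM 8 for the full kernel, where the centre
`j = n/2` carries `λ = 0` and `v(r_{n/2}^{(s)}) ≥ L` (LEMMA 1 centre case); ADDENDUM THEOREM 8⁺: no level
hypothesis beyond `L + 1 ≤ A`). Nothing here is about ζ(5); no irrationality content; filing moves no rung. Filed by
the engine seat zi-eng (g9); inputs `BrickResidueLawCirc.residueLaw_circ{,_zero}` (° cells, level-free),
`BrickHoleCells` (fact (K)), `BrickLaurentValuation.laurent_centre`.

## The statements (`p` odd prime, `2B ≤ A`, `ε ≤ 1`, `n = n₀ + Np`, `n₀ < p`, `N < p^{L+1}`, `L + 1 ≤ A`)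

* `blockWeight A B ε p n₀ N g K := Σ_{k₀ ≤ n₀} g(k₀ + Kp)·(cTop A B ε n (k₀+Kp) / cTop A B 0 N K)` — zi-p2's `W°(K)`
  (the exact centre contributes `λ = 0` automatically: `cTop_one_centre`).
* `sum_range_blocks`, `sum_range_digit_split`: `Σ_{k≤n} F(k) = Σ_{k₀≤n₀}Σ_{K≤N} F(k₀+Kp) + Σ_{n₀<k₀<p}Σ_{K<N} F(k₀+Kp)`.
* `centre_cell_le`, `centre_cellZero_le`: `v(r_{n/2}^{(s)}(n)) ≥ L+1` at level `L+1` (`ε = 1`).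
* `hole_term_le`, `hole_termZero_le`: `v(g(k)·r_k^{(s)}(n)) ≥ L+1` for hole cells (`n₀ < k₀`), `L + 1 ≤ A`.
* **`level_reduction`** (cells `s ≥ 1`) and **`level_reduction_zero`** (harmonic cell):
  `v(Σ_{k≤n} g(k)·p^{(L+1)(A−s)}c_{k,s}(n) − Σ_{K≤N} W(K)·p^{L(A−s)}c̃_{K,s}(N)) ≤ exp(−(L+1))`.
-/

namespace Summit.KontsevichZagierPeriods.Zeta5Search.BrickLevelReduction

open Finset Nat WithZero
open Summit.KontsevichZagierPeriods.Zeta5Search.BrickTopCoefficient (cTop)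
open Summit.KontsevichZagierPeriods.Zeta5Search.BrickLaurent (laurent cell)
open Summit.KontsevichZagierPeriods.Zeta5Search.BrickLaurentValuation (laurent_centre)
open Summit.KontsevichZagierPeriods.Zeta5Search.BrickPartialFractions (cellZero)
open Summit.KontsevichZagierPeriods.Zeta5Search.BrickLambda (cTop_zero_ne_zero)
open Summit.KontsevichZagierPeriods.Zeta5Search.BrickTopKummer (laurent_valuation_abs)
open Summit.KontsevichZagierPeriods.Zeta5Search.BrickHarmonicBlocks (hsum)
open Summit.KontsevichZagierPeriods.Zeta5Search.BrickDigitStepDZero (cellZero_eq hsum_valuation)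
open Summit.KontsevichZagierPeriods.Zeta5Search.BrickResidueLawMain (level_laurent_integral level_hsum_integral)
open Summit.KontsevichZagierPeriods.Zeta5Search.BrickHoleCells (pow_mul_cell_valuation pow_mul_cell_one_valuation
  holeCell_le holeCellZero_le one_le_padicValNat_choose_of_mod_lt)
open Summit.KontsevichZagierPeriods.Zeta5Search.BrickResidueLawCirc (residueLaw_circ residueLaw_circ_zero
  lambda_circ_le_one)

noncomputable section

variable {p : ℕ} [Fact p.Prime]

/-! ## The degree-zero block weight -/

/-- **zi-p2's degree-zero block weight** `W°(K) = Σ_{k₀ ≤ n₀} g(k₀ + Kp)·λ_{k₀+Kp}` of the row `n = n₀ + Np`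
(kernel `ε`), `λ_k = cTop A B ε n k / cTop A B 0 N K` (`= 0` at the exact centre of the full kernel). -/
def blockWeight (A B ε p n₀ N : ℕ) (g : ℕ → ℚ) (K : ℕ) : ℚ :=
  ∑ k₀ ∈ range (n₀ + 1), g (k₀ + K * p) * (cTop A B ε (n₀ + N * p) (k₀ + K * p) / cTop A B 0 N K)

omit [Fact p.Prime] in
/-- At the exact centre the full kernel's top coefficient vanishes: `cTop A B 1 n (n/2) = 0`. -/
theorem cTop_one_centre (A B : ℕ) {n k : ℕ} (h : 2 * k = n) : cTop A B 1 n k = 0 := by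
  unfold cTop
  rw [show (n : ℚ) / 2 - k = 0 by rw [← h]; push_cast; ring, pow_one, mul_zero, zero_mul, zero_mul]

/-! ## Splitting a row into digit blocks -/

omit [Fact p.Prime] in
/-- `Σ_{k < Np} F(k) = Σ_{K<N} Σ_{k₀<p} F(k₀ + Kp)`. -/
theorem sum_range_blocks {M : Type*} [AddCommMonoid M] (F : ℕ → M) (N : ℕ) :
    ∑ k ∈ range (N * p), F k = ∑ K ∈ range N, ∑ k₀ ∈ range p, F (k₀ + K * p) := by
  induction N with
  | zero => simp
  | succ N ih =>
    rw [show (N + 1) * p = N * p + p by ring, Finset.sum_range_add, ih, Finset.sum_range_succ]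
    congr 1
    exact Finset.sum_congr rfl fun k₀ _ => by rw [add_comm]

omit [Fact p.Prime] in
/-- **Digit split of a row**: `Σ_{k ≤ n₀+Np} F(k) = Σ_{k₀≤n₀} Σ_{K≤N} F(k₀+Kp) + Σ_{n₀<k₀<p} Σ_{K<N} F(k₀+Kp)`
(° cells and hole cells). -/
theorem sum_range_digit_split {M : Type*} [AddCommMonoid M] (F : ℕ → M) {n₀ : ℕ} (hn₀ : n₀ < p) (N : ℕ) :
    ∑ k ∈ range (n₀ + N * p + 1), F k =
      ∑ k₀ ∈ range (n₀ + 1), ∑ K ∈ range (N + 1), F (k₀ + K * p) +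
        ∑ k₀ ∈ Ico (n₀ + 1) p, ∑ K ∈ range N, F (k₀ + K * p) := by
  rw [show n₀ + N * p + 1 = N * p + (n₀ + 1) by ring, Finset.sum_range_add, sum_range_blocks]
  have hsplit : ∀ K : ℕ, ∑ k₀ ∈ range p, F (k₀ + K * p) =
      ∑ k₀ ∈ range (n₀ + 1), F (k₀ + K * p) + ∑ k₀ ∈ Ico (n₀ + 1) p, F (k₀ + K * p) := fun K => by
    rw [Finset.range_eq_Ico, Finset.range_eq_Ico, Finset.sum_Ico_consecutive _ (Nat.zero_le _) (by omega)]
  simp only [hsplit, Finset.sum_add_distrib]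
  rw [Finset.sum_comm (s := range (n₀ + 1)) (t := range (N + 1)), Finset.sum_range_succ (fun K => ∑ k₀ ∈ range (n₀ + 1), _),
    Finset.sum_comm (s := Ico (n₀ + 1) p) (t := range N)]
  have hlast : ∑ x ∈ range (n₀ + 1), F (N * p + x) = ∑ k₀ ∈ range (n₀ + 1), F (k₀ + N * p) :=
    Finset.sum_congr rfl fun k₀ _ => by rw [add_comm]
  rw [hlast]
  abel

/-! ## The exact centre and the hole cells are negligible -/

section negligible

variable (hp2 : p ≠ 2) {A B L n : ℕ} (hAB : 2 * B ≤ A) (hn : n < p ^ (L + 1 + 1))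
include hp2 hAB hn

/-- **The centre cell at level `L+1`** (`ε = 1`, `2k = n`): `v(p^{(L+1)(A−s)}·c_{k,s}(n)) ≤ exp(−(L+1))` —
the cell is the `ε = 0` cell one depth lower. -/
theorem centre_cell_le {k : ℕ} (hk : k ≤ n) (hc : 2 * k = n) (s : ℕ) :
    Rat.padicValuation p ((p : ℚ) ^ ((L + 1) * (A - s)) * cell A B 1 n k s) ≤ exp (-((L : ℤ) + 1)) := by
  rw [cell]
  rcases Nat.eq_zero_or_pos (A - s) with h0 | h0
  · rw [h0, (laurent_centre A B hc 0).2, mul_zero, map_zero]; exact _root_.zero_le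
  · obtain ⟨d, hd⟩ : ∃ d, A - s = d + 1 := ⟨A - s - 1, by omega⟩
    rw [hd, (laurent_centre A B hc d).1, map_mul, map_pow, Rat.padicValuation_self, ← exp_nsmul]
    refine (mul_le_mul' le_rfl (laurent_valuation_abs hp2 hAB (ε := 0) hn hk (Or.inr rfl) d)).trans ?_
    rw [← exp_add, exp_le_exp, nsmul_eq_mul]
    push_cast
    nlinarith

/-- **The centre harmonic cell at level `L+1`**: `v(p^{(L+1)A}·cell^{(0)}_k(n)) ≤ exp(−(L+1))` (`2k = n`). -/
theorem centre_cellZero_le {k : ℕ} (hk : k ≤ n) (hc : 2 * k = n) :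
    Rat.padicValuation p ((p : ℚ) ^ ((L + 1) * A) * cellZero A B 1 n k) ≤ exp (-((L : ℤ) + 1)) := by
  have hklt : k < p ^ (L + 1 + 1) := lt_of_le_of_lt hk hn
  rw [cellZero_eq, mul_neg, Valuation.map_neg, Finset.mul_sum]
  refine Valuation.map_sum_le _ fun s hs => ?_
  have hs' := mem_Icc.1 hs
  rw [show (p : ℚ) ^ ((L + 1) * A) * (cell A B 1 n k s * hsum s k) =
      ((p : ℚ) ^ ((L + 1) * (A - s)) * cell A B 1 n k s) * ((p : ℚ) ^ ((L + 1) * s) * hsum s k) by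
    rw [show (L + 1) * A = (L + 1) * (A - s) + (L + 1) * s by rw [← mul_add, Nat.sub_add_cancel hs'.2], pow_add]; ring,
    map_mul]
  calc _ ≤ exp (-((L : ℤ) + 1)) * 1 := mul_le_mul' (centre_cell_le hp2 hAB hn hk hc s) (level_hsum_integral hklt s)
    _ = _ := mul_one _

omit hn in
/-- **Hole cells are negligible** (fact (K), `ε ≤ 1`): for `k ≤ n < p^{L+2}` with `n % p < k % p` and `L + 1 ≤ A`,
any `g ∈ ℤ_(p)`: `v(g·p^{(L+1)(A−s)}·c_{k,s}(n)) ≤ exp(−(L+1))`. -/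
theorem hole_term_le (hn : n < p ^ (L + 1 + 1)) {ε : ℕ} (hε : ε ≤ 1) (hLA : L + 1 ≤ A) {k : ℕ} (hk : k ≤ n)
    (hhole : n % p < k % p) {g : ℚ} (hg : Rat.padicValuation p g ≤ 1) (s : ℕ) :
    Rat.padicValuation p (g * ((p : ℚ) ^ ((L + 1) * (A - s)) * cell A B ε n k s)) ≤ exp (-((L : ℤ) + 1)) := by
  have hv : (1 : ℤ) ≤ padicValNat p (n.choose k) := by exact_mod_cast one_le_padicValNat_choose_of_mod_lt hk hhole
  have hcell : Rat.padicValuation p ((p : ℚ) ^ ((L + 1) * (A - s)) * cell A B ε n k s) ≤ exp (-(A : ℤ)) := by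
    have h : Rat.padicValuation p ((p : ℚ) ^ ((L + 1) * (A - s)) * cell A B ε n k s) ≤
        exp (((L + 1 : ℕ) : ℤ) * (A - s : ℕ) - ((L + 1) * (A - s) : ℕ) - ((A * padicValNat p (n.choose k) : ℕ) : ℤ)) := by
      rcases Nat.le_one_iff_eq_zero_or_eq_one.1 hε with h0 | h1
      · subst h0; exact pow_mul_cell_valuation hp2 hAB hn hk (Or.inr rfl) ((L + 1) * (A - s)) s
      · subst h1; exact pow_mul_cell_one_valuation hp2 hAB hn hk ((L + 1) * (A - s)) s
    refine h.trans (exp_le_exp.2 ?_)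
    simp only [Nat.cast_mul]
    nlinarith [mul_nonneg (Int.natCast_nonneg A) (sub_nonneg.2 hv)]
  rw [map_mul]
  calc _ ≤ 1 * exp (-(A : ℤ)) := mul_le_mul' hg hcell
    _ ≤ _ := by rw [one_mul, exp_le_exp]; omega

omit hn in
/-- **Hole harmonic cells are negligible**: the same for `p^{(L+1)A}·cell^{(0)}_k(n)` (`ε ≤ 1`, `L + 1 ≤ A`). -/
theorem hole_termZero_le (hn : n < p ^ (L + 1 + 1)) {ε : ℕ} (hε : ε ≤ 1) (hLA : L + 1 ≤ A) {k : ℕ} (hk : k ≤ n)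
    (hhole : n % p < k % p) {g : ℚ} (hg : Rat.padicValuation p g ≤ 1) :
    Rat.padicValuation p (g * ((p : ℚ) ^ ((L + 1) * A) * cellZero A B ε n k)) ≤ exp (-((L : ℤ) + 1)) := by
  have hklt : k < p ^ (L + 1 + 1) := lt_of_le_of_lt hk hn
  rw [cellZero_eq, mul_neg, mul_neg, Valuation.map_neg, Finset.mul_sum, Finset.mul_sum]
  refine Valuation.map_sum_le _ fun s hs => ?_
  have hs' := mem_Icc.1 hs
  rw [show g * ((p : ℚ) ^ ((L + 1) * A) * (cell A B ε n k s * hsum s k)) =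
      (g * ((p : ℚ) ^ ((L + 1) * (A - s)) * cell A B ε n k s)) * ((p : ℚ) ^ ((L + 1) * s) * hsum s k) by
    rw [show (L + 1) * A = (L + 1) * (A - s) + (L + 1) * s by rw [← mul_add, Nat.sub_add_cancel hs'.2], pow_add]; ring,
    map_mul]
  calc _ ≤ exp (-((L : ℤ) + 1)) * 1 :=
        mul_le_mul' (hole_term_le hp2 hAB hn hε hLA hk hhole hg s) (level_hsum_integral hklt s)
    _ = _ := mul_one _

end negligible

/-! ## The one-level reduction -/

section reduction

variable (hp2 : p ≠ 2) {A B ε N n₀ L : ℕ} (hAB : 2 * B ≤ A) (hε : ε ≤ 1) (hn₀ : n₀ < p) (hN : N < p ^ (L + 1))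
  (hLA : L + 1 ≤ A) {g : ℕ → ℚ} (hg : ∀ k, k ≤ n₀ + N * p → Rat.padicValuation p (g k) ≤ 1)
include hp2 hAB hε hn₀ hN hLA hg

omit hp2 hAB hε hLA hg in
/-- The row `n = n₀ + Np` has level `≤ L+1`. -/
theorem row_lt : n₀ + N * p < p ^ (L + 1 + 1) := by
  have hp : p.Prime := Fact.out
  calc n₀ + N * p < p + N * p := by omega
    _ = (N + 1) * p := by ring
    _ ≤ p ^ (L + 1) * p := Nat.mul_le_mul_right _ hN
    _ = p ^ (L + 1 + 1) := by ring

/-- **ONE-LEVEL REDUCTION, cells `s ≥ 1`**: `v(Σ_{k≤n} g(k)·p^{(L+1)(A−s)}c_{k,s}(n) − Σ_{K≤N} W(K)·p^{L(A−s)}c̃_{K,s}(N))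
≤ exp(−(L+1))` (`W = blockWeight`): holes discarded termwise, the centre carries `λ = 0`, ° cells by the residue law. -/
theorem level_reduction (s : ℕ) :
    Rat.padicValuation p (∑ k ∈ range (n₀ + N * p + 1), g k * ((p : ℚ) ^ ((L + 1) * (A - s)) * cell A B ε (n₀ + N * p) k s) -
      ∑ K ∈ range (N + 1), blockWeight A B ε p n₀ N g K * ((p : ℚ) ^ (L * (A - s)) * cell A B 0 N K s)) ≤
      exp (-((L : ℤ) + 1)) := by
  have hp : p.Prime := Fact.out
  have hn := row_lt hn₀ hN
  set n := n₀ + N * p with hn_def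
  -- split the row into ° cells and holes
  rw [sum_range_digit_split (p := p) _ hn₀ N]
  -- the ° part minus the block weights, cell by cell
  have hcirc : ∑ k₀ ∈ range (n₀ + 1), ∑ K ∈ range (N + 1),
      g (k₀ + K * p) * ((p : ℚ) ^ ((L + 1) * (A - s)) * cell A B ε n (k₀ + K * p) s) -
      ∑ K ∈ range (N + 1), blockWeight A B ε p n₀ N g K * ((p : ℚ) ^ (L * (A - s)) * cell A B 0 N K s) =
      ∑ k₀ ∈ range (n₀ + 1), ∑ K ∈ range (N + 1), g (k₀ + K * p) *
        ((p : ℚ) ^ ((L + 1) * (A - s)) * cell A B ε n (k₀ + K * p) s -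
          cTop A B ε n (k₀ + K * p) / cTop A B 0 N K * ((p : ℚ) ^ (L * (A - s)) * cell A B 0 N K s)) := by
    simp only [blockWeight, ← hn_def, Finset.sum_mul, mul_sub, Finset.sum_sub_distrib]
    rw [Finset.sum_comm (s := range (N + 1)) (t := range (n₀ + 1))]
    congr 1
    exact Finset.sum_congr rfl fun k₀ _ => Finset.sum_congr rfl fun K _ => by ring
  rw [add_sub_right_comm, hcirc]
  refine Valuation.map_add_le _ (Valuation.map_sum_le _ fun k₀ hk₀ => Valuation.map_sum_le _ fun K hK => ?_)
    (Valuation.map_sum_le _ fun k₀ hk₀ => Valuation.map_sum_le _ fun K hK => ?_)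
  · -- a ° cell
    have hk₀' := mem_range.1 hk₀
    have hK' := mem_range.1 hK
    have hkn : k₀ + K * p ≤ n := by rw [hn_def]; nlinarith
    rw [map_mul]
    refine (mul_le_mul' (hg _ hkn) ?_).trans (by rw [one_mul])
    by_cases hc : 2 * (k₀ + K * p) ≠ n ∨ ε = 0
    · exact residueLaw_circ hp2 hAB rfl rfl hN hn₀ (by omega) (by omega) hc
        (div_mul_cancel₀ _ (cTop_zero_ne_zero (by omega) A B)) s
    · have hε1 : ε = 1 := by omega
      have hcen : 2 * (k₀ + K * p) = n := by by_contra h; exact hc (Or.inl h)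
      subst hε1
      rw [cTop_one_centre A B hcen, zero_div, zero_mul, sub_zero]
      exact centre_cell_le hp2 hAB hn hkn hcen s
  · -- a hole cell
    have hk₀' := mem_Ico.1 hk₀
    have hK' := mem_range.1 hK
    have hkn : k₀ + K * p ≤ n := by rw [hn_def]; nlinarith
    refine hole_term_le hp2 hAB hn hε hLA hkn ?_ (hg _ hkn) s
    rw [hn_def, Nat.add_mul_mod_self_right, Nat.add_mul_mod_self_right, Nat.mod_eq_of_lt hn₀,
      Nat.mod_eq_of_lt hk₀'.2]
    omega

/-- **ONE-LEVEL REDUCTION, harmonic cell `s = 0`**: the same with `p^{(L+1)A}·cell^{(0)}_k(n)` and `p^{LA}·cell̃^{(0)}_K(N)`. -/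
theorem level_reduction_zero :
    Rat.padicValuation p (∑ k ∈ range (n₀ + N * p + 1), g k * ((p : ℚ) ^ ((L + 1) * A) * cellZero A B ε (n₀ + N * p) k) -
      ∑ K ∈ range (N + 1), blockWeight A B ε p n₀ N g K * ((p : ℚ) ^ (L * A) * cellZero A B 0 N K)) ≤
      exp (-((L : ℤ) + 1)) := by
  have hp : p.Prime := Fact.out
  have hn := row_lt hn₀ hN
  set n := n₀ + N * p with hn_def
  rw [sum_range_digit_split (p := p) _ hn₀ N]
  have hcirc : ∑ k₀ ∈ range (n₀ + 1), ∑ K ∈ range (N + 1),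
      g (k₀ + K * p) * ((p : ℚ) ^ ((L + 1) * A) * cellZero A B ε n (k₀ + K * p)) -
      ∑ K ∈ range (N + 1), blockWeight A B ε p n₀ N g K * ((p : ℚ) ^ (L * A) * cellZero A B 0 N K) =
      ∑ k₀ ∈ range (n₀ + 1), ∑ K ∈ range (N + 1), g (k₀ + K * p) *
        ((p : ℚ) ^ ((L + 1) * A) * cellZero A B ε n (k₀ + K * p) -
          cTop A B ε n (k₀ + K * p) / cTop A B 0 N K * ((p : ℚ) ^ (L * A) * cellZero A B 0 N K)) := by
    simp only [blockWeight, ← hn_def, Finset.sum_mul, mul_sub, Finset.sum_sub_distrib]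
    rw [Finset.sum_comm (s := range (N + 1)) (t := range (n₀ + 1))]
    congr 1
    exact Finset.sum_congr rfl fun k₀ _ => Finset.sum_congr rfl fun K _ => by ring
  rw [add_sub_right_comm, hcirc]
  refine Valuation.map_add_le _ (Valuation.map_sum_le _ fun k₀ hk₀ => Valuation.map_sum_le _ fun K hK => ?_)
    (Valuation.map_sum_le _ fun k₀ hk₀ => Valuation.map_sum_le _ fun K hK => ?_)
  · have hk₀' := mem_range.1 hk₀
    have hK' := mem_range.1 hK
    have hkn : k₀ + K * p ≤ n := by rw [hn_def]; nlinarith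
    rw [map_mul]
    refine (mul_le_mul' (hg _ hkn) ?_).trans (by rw [one_mul])
    by_cases hc : 2 * (k₀ + K * p) ≠ n ∨ ε = 0
    · exact residueLaw_circ_zero hp2 hAB rfl rfl hN hn₀ (by omega) (by omega) hc
        (div_mul_cancel₀ _ (cTop_zero_ne_zero (by omega) A B))
    · have hε1 : ε = 1 := by omega
      have hcen : 2 * (k₀ + K * p) = n := by by_contra h; exact hc (Or.inl h)
      subst hε1
      rw [cTop_one_centre A B hcen, zero_div, zero_mul, sub_zero]
      exact centre_cellZero_le hp2 hAB hn hkn hcen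
  · have hk₀' := mem_Ico.1 hk₀
    have hK' := mem_range.1 hK
    have hkn : k₀ + K * p ≤ n := by rw [hn_def]; nlinarith
    refine hole_termZero_le hp2 hAB hn hε hLA hkn ?_ (hg _ hkn)
    rw [hn_def, Nat.add_mul_mod_self_right, Nat.add_mul_mod_self_right, Nat.mod_eq_of_lt hn₀,
      Nat.mod_eq_of_lt hk₀'.2]
    omega

end reduction

end

end Summit.KontsevichZagierPeriods.Zeta5Search.BrickLevelReduction
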